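import Summits.QuantumFields.BalabanUV.T4Continuum.Support.NE7SliceTangentPartLimitNL
import HarnessLib

/-!
# NE7SliceLimitNL — THE CONTINUITY HALF FOR THE (S1) ITERATION ON THE NONLINEAR FRAME TARGET, ONE-CALL SHAPE ((R1′), named ask [NE7P1-G103-ASK-4], companion of
# `NE7SliceTangentPartLimitNL`): from exactly the data the re-issued `slice_orbit` delivers — per-`j` working-region facts, a unitary `(tower)`-periodic SITEWISE limit `u⋆`, a geometric rate
# `‖u j y − u⋆ y‖ ≤ C·ϑ^j`, `D̃f(u j) ≤ ϑ^j·δ₀` — plus the road's (LP) letter (`hLP`, free `KP ≥ 0`) and NL state facts LEMMA-SHAPED (`hskewNL`: `φ̃` skew on the working region; `hsplitNL`: the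
# normalised split of `(T̃, h̃)` exists there; `hperNL`: the `m̃`-integrand is `N`-periodic there): `T̃(u⋆) ∈ 𝒯_E(W)`, `framePotW T̃(u⋆) = h̃(u⋆)`,
# `mlog v_{k+1}(X(u⋆)) = h(u⋆) + framePotW Ñ(u⋆)` ((1.37) up to the N-frame) and `m̃(u⋆) = 0`

Cell `pub-balaban`, rung (B)+1 sub-cell t4, lineage `b2b-balaban-t4-ne7b-p1`, generation 151 (OWNER of BINDER row NE7b; junction service for the NE crew, ruling R-OWNER-149-1 (2)).
The chart∕corner facts at `u⋆` come from gen 150's `NE7SliceLimitWorkingRegion.workingRegion_of_limit`; the rest is `NE7SliceTangentPartLimitNL` §3 with `r j := C·ϑ^j`.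
WHAT ([folklore]; 0 def, 0 sorry).  **`limitNL_of_geometric`** (the four conclusions as a conjunction, binders = the re-issued `slice_orbit`'s outputs + `hLP`, `hskewNL`, `hsplitNL`, `hperNL`).
HONEST FRAMING (page 1): bookkeeping by name; the displayed hypotheses are the road's (LP) and NL state facts, asserted for nothing here; NOT the re-issued (S1) engine, NOT (S2), NOT NE7, nothing of
row NE7b; spine 0∕9; finite T⁴ rung (B)+1 — NOT infinite volume, NOT mass gap, NOT BetaPertH, NOT Clay.  Continuum YM on T⁴ ⇐ BetaPertH ∧ nine spine estimates (0/9 proved); BetaPertH ⇐ (D1) ∧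
(D4) ∧ CAP+tail; G-an2-4 gates asym, D1 and NE2/3/4.
-/

set_option autoImplicit false

open scoped BigOperators Matrix.Norms.L2Operator Topology
open NormedSpace Finset Filter

namespace Summit.QuantumFields.BalabanUV.T4Continuum.NE7SliceLimitNL

open Literature.MathematicalPhysics.QuantumFieldTheory.Balaban1983to89
open B7Prop1Explicit B7Prop2Explicit MatrixLog
open B7Eq92Concrete (vcov)
open T4AveragingDeficitWall (IsUnitaryCfg IsSkewDir SmallField vary)
open T4AveragingDeficitWallBoundary (IsPeriodicCfg)
open AveragingDeficitPeriodicCounting (IsPeriodicDir)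
open AveragingDeficitMultiLevelPrep (cavgIter LevelSmall tower)
open BlockAveragePushDirGauge (gaugeDir isPeriodicDir_gaugeDir)
open NE3EnergyShapes (IsUnitarySite IsPeriodicSite)
open NE3TangentCovariantTower (framePotW)
open NE3QbarIterCovLiftPrep (cruxC)
open NE3SmoothRightInverseW (rightInvW)
open NE3LinearisedAverageSup (curvSum levelData)
open NE3RightInverseSupLetters (norm_rightInvW_le norm_gaugeDir_le_two_mul supC)
open NE3.PairLandauB8Avg (relPert)
open NE7MeanZeroGaugeSliceW (energyBlockLandauW)
open NE7RightInverseLinear (rightInvW_sub)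
open NE7EnergySliceClosed (mem_energyBlockLandauW_of_tendsto)
open NE7SliceIterationState (repLog cornerLog coarseDatum IsNormalisedSplit siteSup_le siteSup_nonneg le_siteSup bondSup le_bondSup bondSup_nonneg)
open NE7SliceIterationStateNL
open NE7SliceTangentPartLimit (norm_repLog_sub_le_sup norm_cornerLog_sub_le norm_coarseDatum_sub_le)
open NE7SliceFrameMatchingLimit (framePotW_sub norm_framePotW_sub_le lipT_nonneg)
open NE7SliceLimitWorkingRegion (workingRegion_of_limit)
open NE7SliceTangentPartLimitNL (tangentPartNL_limit_mem framePotW_NL_limit_eq mlog_vcov_limit_eq frameMismatchNL_limit_eq_zero)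

noncomputable section

variable {d : ℕ} {n : Type*} [Fintype n] [DecidableEq n] [Nonempty n]

/-! ## §4 The limit — one-call geometric shape, NL facts lemma-shaped -/

section Geometric

variable {L : ℕ} (hL : 2 ≤ L) (k : ℕ) {W : Site d → Fin d → (Matrix n n ℂ)ˣ} {x : ℝ} (hWu : IsUnitaryCfg W) (hx : 0 ≤ x) (hs : LevelSmall d L k x)
  (hWx : SmallField W x) (N : ℕ) [NeZero N] (hθ : cruxC d L * (((L : ℝ) ^ (k + 1)) ^ 2 * x) < 1) (U' : Site d → Fin d → (Matrix n n ℂ)ˣ)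
  (hWP : IsPeriodicCfg W ((tower L N (k + 1) : ℕ) : ℤ)) (hU'u : IsUnitaryCfg U') (hU'P : IsPeriodicCfg U' ((tower L N (k + 1) : ℕ) : ℤ))
  (hε : ((L : ℝ) ^ (k + 1)) ^ 2 * x ≤ 1) (hA : curvSum d L (k + 1) x ≤ 2 / 3 * L)
  {KP : ℝ} (hKP : 0 ≤ KP)
  (hLP : ∀ (X X' : Site d → Fin d → Matrix n n ℂ) (bX : ℝ), (∀ y κ, ‖X y κ‖ ≤ 1 / 8) → (∀ y κ, ‖X' y κ‖ ≤ 1 / 8) → 0 ≤ bX →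
    (∀ y κ, ‖X y κ - X' y κ‖ ≤ bX) → ∀ z : Site d,
      ‖(mlog ((vcov L W (relPert W X) (k + 1) z : (Matrix n n ℂ)ˣ) : Matrix n n ℂ) - framePotW L (k + 1) W X z)
          - (mlog ((vcov L W (relPert W X') (k + 1) z : (Matrix n n ℂ)ˣ) : Matrix n n ℂ) - framePotW L (k + 1) W X' z)‖ ≤ KP * bX)
  -- the road's NL state facts, lemma-shaped: on the working region `φ̃` is skew, the normalised split exists, the `m̃`-integrand is `N`-periodic
  (hskewNL : ∀ w : Site d → (Matrix n n ℂ)ˣ, IsUnitarySite w → IsPeriodicSite w ((tower L N (k + 1) : ℕ) : ℤ) → gaugeAct w U' = vary W (repLog W U' w) 1 →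
    (∀ y κ, ‖repLog W U' w y κ‖ ≤ 1 / 8) → (∀ z, ((w (((L : ℤ) ^ (k + 1)) • z) : (Matrix n n ℂ)ˣ) : Matrix n n ℂ) = exp (cornerLog L k w z)) →
    (∀ z, ‖cornerLog L k w z‖ ≤ 1 / 8) → IsSkewDir (coarseDatumNL L k W U' w))
  (hsplitNL : ∀ w : Site d → (Matrix n n ℂ)ˣ, IsUnitarySite w → IsPeriodicSite w ((tower L N (k + 1) : ℕ) : ℤ) → gaugeAct w U' = vary W (repLog W U' w) 1 →
    (∀ y κ, ‖repLog W U' w y κ‖ ≤ 1 / 8) → (∀ z, ((w (((L : ℤ) ^ (k + 1)) • z) : (Matrix n n ℂ)ˣ) : Matrix n n ℂ) = exp (cornerLog L k w z)) →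
    (∀ z, ‖cornerLog L k w z‖ ≤ 1 / 8) → ∃ p : (Site d → Matrix n n ℂ) × (Site d → Fin d → Matrix n n ℂ),
      IsNormalisedSplit L k N W (tangentPartNL hL k hWu hx hs hWx N hθ U' w) (effCornerLog L k W U' w) p.1 p.2)
  (hperNL : ∀ w : Site d → (Matrix n n ℂ)ˣ, IsUnitarySite w → IsPeriodicSite w ((tower L N (k + 1) : ℕ) : ℤ) → gaugeAct w U' = vary W (repLog W U' w) 1 →
    (∀ y κ, ‖repLog W U' w y κ‖ ≤ 1 / 8) → (∀ z, ((w (((L : ℤ) ^ (k + 1)) • z) : (Matrix n n ℂ)ˣ) : Matrix n n ℂ) = exp (cornerLog L k w z)) →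
    (∀ z, ‖cornerLog L k w z‖ ≤ 1 / 8) → ∀ (z : Site d) (i : Fin d),
      framePotW L (k + 1) W (tangentPartNL hL k hWu hx hs hWx N hθ U' w) (z + (N : ℤ) • e i) - effCornerLog L k W U' w (z + (N : ℤ) • e i)
        = framePotW L (k + 1) W (tangentPartNL hL k hWu hx hs hWx N hθ U' w) z - effCornerLog L k W U' w z)
  (u : ℕ → Site d → (Matrix n n ℂ)ˣ) (ulim : Site d → (Matrix n n ℂ)ˣ)
  (hu : ∀ j, IsUnitarySite (u j)) (huP : ∀ j, IsPeriodicSite (u j) ((tower L N (k + 1) : ℕ) : ℤ))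
  (hgu : ∀ j, gaugeAct (u j) U' = vary W (repLog W U' (u j)) 1) (hXu : ∀ j y κ, ‖repLog W U' (u j) y κ‖ ≤ 1 / 8)
  (hcu : ∀ j z, (((u j) (((L : ℤ) ^ (k + 1)) • z) : (Matrix n n ℂ)ˣ) : Matrix n n ℂ) = exp (cornerLog L k (u j) z)) (hhu : ∀ j z, ‖cornerLog L k (u j) z‖ ≤ 1 / 8)
  (hl : IsUnitarySite ulim) (hlP : IsPeriodicSite ulim ((tower L N (k + 1) : ℕ) : ℤ))
  (hconv : ∀ y, Tendsto (fun j => (((u j) y : (Matrix n n ℂ)ˣ) : Matrix n n ℂ)) atTop (𝓝 ((ulim y : (Matrix n n ℂ)ˣ) : Matrix n n ℂ)))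
  {C ϑ δ₀ : ℝ} (hϑ0 : 0 ≤ ϑ) (hϑ1 : ϑ < 1)
  (hrate : ∀ j y, ‖(((u j) y : (Matrix n n ℂ)ˣ) : Matrix n n ℂ) - (ulim y : (Matrix n n ℂ)ˣ)‖ ≤ C * ϑ ^ j)
  (hDf : ∀ j, sliceDefectNL hL k hWu hx hs hWx N hθ U' (u j) ≤ ϑ ^ j * δ₀)

include hWP hU'u hU'P hε hA hKP hLP hskewNL hsplitNL hperNL hu huP hgu hXu hcu hhu hl hlP hconv hϑ0 hϑ1 hrate hDf in
/-- **`T̃(u⋆) ∈ 𝒯_E(W)`, `framePotW T̃(u⋆) = h̃(u⋆)`, `mlog v_{k+1}(X(u⋆)) = h(u⋆) + framePotW Ñ(u⋆)` and `m̃(u⋆) = 0` IN ONE CALL** from the data the re-issued `slice_orbit` delivers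
(per-`j` working-region facts, unitary `(tower)`-periodic sitewise limit, geometric rate `C·ϑ^j`, `D̃f(u j) ≤ ϑ^j·δ₀`) plus the road's (LP) and NL state facts, lemma-shaped.
The chart∕corner facts at `u⋆` come from `NE7SliceLimitWorkingRegion.workingRegion_of_limit`. [folklore] -/
theorem limitNL_of_geometric :
    tangentPartNL hL k hWu hx hs hWx N hθ U' ulim ∈ energyBlockLandauW (d := d) (n := n) L N (k + 1) W ∧
      (∀ z, framePotW L (k + 1) W (tangentPartNL hL k hWu hx hs hWx N hθ U' ulim) z = effCornerLog L k W U' ulim z) ∧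
      (∀ z, mlog ((vcov L W (relPert W (repLog W U' ulim)) (k + 1) z : (Matrix n n ℂ)ˣ) : Matrix n n ℂ)
        = cornerLog L k ulim z + framePotW L (k + 1) W (normalPartNL hL k hWu hx hs hWx N hθ U' ulim) z) ∧
      frameMismatchNL hL k hWu hx hs hWx N hθ U' ulim = 0 := by
  obtain ⟨hgl, hXl, hcl, hhl⟩ := workingRegion_of_limit k hWu hU'u hu hl hconv hgu hXu hcu hhu
  have hpow : Tendsto (fun j => ϑ ^ j) atTop (𝓝 0) := tendsto_pow_atTop_nhds_zero_of_lt_one hϑ0 hϑ1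
  have hr : Tendsto (fun j => C * ϑ ^ j) atTop (𝓝 0) := by simpa using hpow.const_mul C
  have hDf0 : Tendsto (fun j => sliceDefectNL hL k hWu hx hs hWx N hθ U' (u j)) atTop (𝓝 0) := by
    have hup : Tendsto (fun j => ϑ ^ j * δ₀) atTop (𝓝 0) := by simpa using hpow.mul_const δ₀
    exact squeeze_zero (fun j => sliceDefectNL_nonneg hL k hWu hx hs hWx N hθ U' (u j)) hDf hup
  have hφj : ∀ j, IsSkewDir (coarseDatumNL L k W U' (u j)) := fun j => hskewNL (u j) (hu j) (huP j) (hgu j) (hXu j) (hcu j) (hhu j)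
  have hφl : IsSkewDir (coarseDatumNL L k W U' ulim) := hskewNL ulim hl hlP hgl hXl hcl hhl
  have hexj := fun j => hsplitNL (u j) (hu j) (huP j) (hgu j) (hXu j) (hcu j) (hhu j)
  have hperj := fun j => hperNL (u j) (hu j) (huP j) (hgu j) (hXu j) (hcu j) (hhu j)
  refine ⟨?_, ?_, ?_, ?_⟩
  · exact tangentPartNL_limit_mem hL k hWu hx hs hWx N hθ U' hWP hU'u hU'P hε hA hKP hLP u ulim hu huP hgu hXu hcu hhu hl hlP hgl hXl hcl hhl hφj hφl hexj
      (fun j => C * ϑ ^ j) hrate hr hDf0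
  · exact framePotW_NL_limit_eq hL k hWu hx hs hWx N hθ U' hWP hU'u hU'P hε hA hKP hLP u ulim hu huP hgu hXu hcu hhu hl hlP hgl hXl hcl hhl hφj hφl hperj
      (fun j => C * ϑ ^ j) hrate hr hDf0
  · exact mlog_vcov_limit_eq hL k hWu hx hs hWx N hθ U' hWP hU'u hU'P hε hA hKP hLP u ulim hu huP hgu hXu hcu hhu hl hlP hgl hXl hcl hhl hφj hφl hperj
      (fun j => C * ϑ ^ j) hrate hr hDf0
  · exact frameMismatchNL_limit_eq_zero hL k hWu hx hs hWx N hθ U' hWP hU'u hU'P hε hA hKP hLP u ulim hu huP hgu hXu hcu hhu hl hlP hgl hXl hcl hhl hφj hφl hperj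
      (fun j => C * ϑ ^ j) hrate hr hDf0

end Geometric

end

end Summit.QuantumFields.BalabanUV.T4Continuum.NE7SliceLimitNL
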